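import Mathlib
import Summits.ValiantsHypothesis.ValiantsHypothesis.Theorems.NewtonFramesNewtonTauWeakBlockConvexThree
import Summits.ValiantsHypothesis.ValiantsHypothesis.Theorems.NewtonFramesNewtonTauWeakBlockConvexFive

/-!
# Crux `NewtonTauWeak` (stmt-ValiantsHypothesis-5904), line `slope-ladder`: `M_{2k-1}(N) ≥ (N/C_k)^k` for every `k`

The LAGRANGE MECHANISM of `…BlockConvexFive` in full generality.  `M_r(N)` = the largest convexly independent subset
of an `r`-fold Minkowski sum of planar `N`-sets ([BBFKOTT10, §5]); STUB 1 of the line (`stub_blockConvexBound`) asks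
for some `r` with `M_r(N) ≤ C (N+2)^{(2/3-δ) r}`, `δ > 0`.  Known lower bounds in print: `M_2(N) = Θ(N^{4/3})`
[BBFKOTT10], `M_r(N) ≥ N^{r/3} - 1` [KoiranPortierTavenasThomasse2015, Prop. 1].  Here:

* `lagrange_sets_parabola k n` — for `k ≥ 1` and every `n`: `2k-1` planar sets of at most `k (2k-1)^{k-1} n` points
  each and `n^k` points of their Minkowski sum in convex position (all on the parabola `y = x²`).  Construction: index
  by `t ∈ [n]^k`, i.e. by `P_t(X) = Σ_{i<k} t_i X^i`; the point is `(P_t(n), P_t(n)²)` (distinct: base-`n` digits);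
  since `deg P_t, deg P_t² ≤ 2k-2`, Lagrange interpolation at the nodes `0, 1, …, 2k-2` gives
  `(P_t(n), P_t(n)²) = Σ_{ℓ<2k-1} L_ℓ(n)·(P_t(ℓ), P_t(ℓ)²)`, and the `ℓ`-th summand lies in
  `{L_ℓ(n)(v, v²) : v < k(2k-1)^{k-1} n}` because `P_t(ℓ)` is a small natural number.
* `blockConvexBound_exponent_lt` — hence for `r = 2k-1` no bound `#S ≤ C (N+2)^e` with `e < k` holds:
  **`M_r(N) ≥ c_r N^{⌈r/2⌉}`**, the exponent of [KPTT15, Prop. 1] rises from `r/3` to `r/2`.  Consequence for the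
  line's ladder: `r`-block convexity can certify no slope below `⌈r/2⌉/r ≥ 1/2`; the typed rung `SlopeThird` is out
  of reach of the whole method family (KPTT's stated ceiling `1/3` becomes `1/2`), `SlopeHalf` at best in the limit.

The stub itself (beat `2/3` for SOME `r`) stays OPEN: `⌈r/2⌉ < 2r/3` for `r ≥ 4`.  Helper for the crux item
(`--supports`); nothing here bears on `NewtonTauWeak` or `VP ≠ VNP`.
-/

set_option linter.dupNamespace false

namespace Summit.ValiantsHypothesis.ValiantsHypothesis.Theorems.NewtonFramesNewtonTauWeak.BlockConvexLagrange

open scoped BigOperators Pointwise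
open Polynomial
open Summit.ValiantsHypothesis.ValiantsHypothesis.Theorems.NewtonFramesNewtonTauWeak.BlockConvexThree
  (parabola_convexIndependent)
open Summit.ValiantsHypothesis.ValiantsHypothesis.Theorems.NewtonFramesNewtonTauWeak.BlockConvexFive
  (no_power_bound)

noncomputable section

/-- `Σᵢ g i ∈ Σᵢ S i` when each `g i ∈ S i` (pointwise finset sums). [folklore] -/
theorem sum_mem_sum' {ι α : Type*} [AddCommMonoid α] [DecidableEq α] (s : Finset ι)
    (S : ι → Finset α) (g : ι → α) (h : ∀ i ∈ s, g i ∈ S i) : ∑ i ∈ s, g i ∈ ∑ i ∈ s, S i := by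
  classical
  induction s using Finset.induction_on with
  | empty => simp
  | insert a s ha ih =>
    rw [Finset.sum_insert ha, Finset.sum_insert ha]
    exact Finset.add_mem_add (h a (Finset.mem_insert_self a s))
      (ih fun i hi => h i (Finset.mem_insert_of_mem hi))

/-- A finite sum of planar points written as `![a, b]` is computed coordinatewise. [folklore] -/
theorem vec2_sum {ι : Type*} (s : Finset ι) (a b : ι → ℝ) :
    ∑ i ∈ s, (![a i, b i] : Fin 2 → ℝ) = ![∑ i ∈ s, a i, ∑ i ∈ s, b i] := by
  funext c
  rw [Finset.sum_apply]
  fin_cases c <;> simp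

/-- **Lagrange reproduces monomials**: `x^d = Σ_{ℓ<m} L_ℓ(x) ℓ^d` for `d < m`, where `L_ℓ` is the Lagrange basis
polynomial for the nodes `0, 1, …, m-1`. [folklore] -/
theorem pow_eq_sum_lagrange (m d : ℕ) (hd : d < m) (x : ℝ) :
    x ^ d = ∑ ℓ ∈ Finset.range m,
      (Lagrange.basis (Finset.range m) (Nat.cast : ℕ → ℝ) ℓ).eval x * (ℓ : ℝ) ^ d := by
  classical
  have hvs : Set.InjOn (Nat.cast : ℕ → ℝ) (Finset.range m : Set ℕ) := Nat.cast_injective.injOn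
  have hdeg : (X ^ d : ℝ[X]).degree < (Finset.range m).card := by
    rw [Polynomial.degree_X_pow, Finset.card_range]
    exact_mod_cast hd
  have h := Lagrange.eq_interpolate (f := X ^ d) hvs hdeg
  have h' := congrArg (Polynomial.eval x) h
  rw [Lagrange.interpolate_apply, Polynomial.eval_finsetSum] at h'
  simp only [Polynomial.eval_pow, Polynomial.eval_X, Polynomial.eval_mul, Polynomial.eval_C] at h'
  rw [h']
  exact Finset.sum_congr rfl fun ℓ _ => by ring

/-- Base-`n` digits are injective: `Σ_{i<k} t_i n^i` determines `t ∈ [n]^k`. [folklore] -/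
theorem digits_injective (n : ℕ) : ∀ (k : ℕ) (t s : Fin k → ℕ), (∀ i, t i < n) → (∀ i, s i < n) →
    ∑ i, t i * n ^ (i : ℕ) = ∑ i, s i * n ^ (i : ℕ) → t = s := by
  intro k
  induction k with
  | zero => intro t s _ _ _; funext i; exact Fin.elim0 i
  | succ k ih =>
    intro t s ht hs h
    have hn : 0 < n := by have := ht 0; omega
    rw [Fin.sum_univ_succ, Fin.sum_univ_succ] at h
    simp only [Fin.val_zero, pow_zero, mul_one, Fin.val_succ, pow_succ] at h
    have htail : ∀ u : Fin (k + 1) → ℕ,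
        ∑ i : Fin k, u i.succ * (n ^ (i : ℕ) * n) = n * ∑ i : Fin k, u i.succ * n ^ (i : ℕ) := by
      intro u
      rw [Finset.mul_sum]
      exact Finset.sum_congr rfl fun i _ => by ring
    rw [htail t, htail s] at h
    have h0 : t 0 = s 0 := by
      have e1 : (t 0 + n * ∑ i : Fin k, t i.succ * n ^ (i : ℕ)) % n = t 0 := by
        rw [Nat.add_mul_mod_self_left, Nat.mod_eq_of_lt (ht 0)]
      have e2 : (s 0 + n * ∑ i : Fin k, s i.succ * n ^ (i : ℕ)) % n = s 0 := by
        rw [Nat.add_mul_mod_self_left, Nat.mod_eq_of_lt (hs 0)]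
      rw [← e1, ← e2, h]
    have h1 : ∑ i : Fin k, t i.succ * n ^ (i : ℕ) = ∑ i : Fin k, s i.succ * n ^ (i : ℕ) :=
      Nat.eq_of_mul_eq_mul_left hn (by omega)
    have h2 := ih (fun i => t i.succ) (fun i => s i.succ) (fun i => ht _) (fun i => hs _) h1
    funext i
    refine Fin.cases ?_ (fun j => ?_) i
    · exact h0
    · exact congrFun h2 j

/-- **Lagrange mechanism: `M_{2k-1}(k (2k-1)^{k-1} n) ≥ n^k`.**  For `k ≥ 1` and every `n` there are `2k-1` planar sets
of at most `k (2k-1)^{k-1} n` points each and `n^k` points of their Minkowski sum in convex position, all on the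
parabola `y = x²` (see the module docstring for the construction). [this file] -/
theorem lagrange_sets_parabola (k n : ℕ) (hk : 1 ≤ k) :
    ∃ (P : Fin (2 * k - 1) → Finset (Fin 2 → ℝ)) (S : Finset (Fin 2 → ℝ)),
      (∀ ℓ, (P ℓ).card ≤ k * (2 * k - 1) ^ (k - 1) * n) ∧ S ⊆ ∑ ℓ, P ℓ ∧
        ConvexIndependent ℝ (Subtype.val : ↥(S : Set (Fin 2 → ℝ)) → (Fin 2 → ℝ)) ∧ S.card = n ^ k := by
  classical
  set m : ℕ := 2 * k - 1 with hm
  have hm1 : 1 ≤ m := by omega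
  set M : ℕ := k * m ^ (k - 1) with hM
  set x : ℝ := (n : ℝ) with hx
  -- Lagrange basis at the nodes 0..m-1, evaluated at `n`
  set L : ℕ → ℝ := fun ℓ => (Lagrange.basis (Finset.range m) (Nat.cast : ℕ → ℝ) ℓ).eval x with hL
  -- value of `P_t` at the node `ℓ` (a natural number) and the `x`-coordinate `P_t(n)`
  set val : ℕ → (Fin k → ℕ) → ℕ := fun ℓ t => ∑ i, t i * ℓ ^ (i : ℕ) with hval
  set φ : (Fin k → ℕ) → ℝ := fun t => ∑ i, (t i : ℝ) * x ^ (i : ℕ) with hφ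
  -- the summands, the index box and the point set
  set Q : ℕ → Finset (Fin 2 → ℝ) := fun ℓ =>
    (Finset.range (M * n)).image fun v : ℕ => (![L ℓ * (v : ℝ), L ℓ * ((v : ℝ) ^ 2)] : Fin 2 → ℝ) with hQ
  set T : Finset (Fin k → ℕ) := Fintype.piFinset fun _ : Fin k => Finset.range n with hT
  set S : Finset (Fin 2 → ℝ) := T.image fun t => (![φ t, (φ t) ^ 2] : Fin 2 → ℝ) with hS
  have hQcard : ∀ ℓ, (Q ℓ).card ≤ M * n := fun ℓ => Finset.card_image_le.trans (by simp)
  refine ⟨fun ℓ => Q (ℓ : ℕ), S, fun ℓ => hQcard _, ?_, ?_, ?_⟩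
  · -- S ⊆ Σ_ℓ Q ℓ
    intro s hs
    obtain ⟨t, ht, rfl⟩ := Finset.mem_image.1 hs
    have htn : ∀ i, t i < n := fun i => Finset.mem_range.1 (Fintype.mem_piFinset.1 ht i)
    have hn1 : 1 ≤ n := by have := htn ⟨0, hk⟩; omega
    -- the node values are small
    have hvalM : ∀ ℓ, ℓ < m → val ℓ t < M * n := by
      intro ℓ hℓ
      have hterm : ∀ i : Fin k, t i * ℓ ^ (i : ℕ) ≤ (n - 1) * m ^ (k - 1) := by
        intro i
        refine Nat.mul_le_mul (by have := htn i; omega) ?_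
        exact (Nat.pow_le_pow_left hℓ.le _).trans (Nat.pow_le_pow_right hm1 (by omega))
      have hsum : val ℓ t ≤ k * ((n - 1) * m ^ (k - 1)) := by
        calc val ℓ t = ∑ i, t i * ℓ ^ (i : ℕ) := rfl
          _ ≤ ∑ _i : Fin k, (n - 1) * m ^ (k - 1) := Finset.sum_le_sum fun i _ => hterm i
          _ = k * ((n - 1) * m ^ (k - 1)) := by simp
      have hMpos : 0 < M := by rw [hM]; exact Nat.mul_pos (by omega) (Nat.pow_pos (by omega))
      have hlt : k * ((n - 1) * m ^ (k - 1)) < M * n := by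
        have : k * ((n - 1) * m ^ (k - 1)) = M * (n - 1) := by rw [hM]; ring
        rw [this]
        exact Nat.mul_lt_mul_of_pos_left (by omega) hMpos
      exact hsum.trans_lt hlt
    -- the summand at node ℓ and its membership
    have hmem : ∀ ℓ : Fin m,
        (![L ℓ * (val ℓ t : ℝ), L ℓ * ((val ℓ t : ℝ) ^ 2)] : Fin 2 → ℝ) ∈ Q (ℓ : ℕ) := fun ℓ =>
      Finset.mem_image.2 ⟨val ℓ t, Finset.mem_range.2 (hvalM ℓ ℓ.2), rfl⟩
    have hsum_mem := sum_mem_sum' (Finset.univ : Finset (Fin m)) (fun ℓ => Q (ℓ : ℕ))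
      (fun ℓ => (![L ℓ * (val ℓ t : ℝ), L ℓ * ((val ℓ t : ℝ) ^ 2)] : Fin 2 → ℝ)) fun ℓ _ => hmem ℓ
    -- Lagrange: Σ_ℓ L ℓ · (val ℓ t)^j = φ(t)^j for j = 1, 2
    have hvalR : ∀ ℓ : ℕ, (val ℓ t : ℝ) = ∑ i, (t i : ℝ) * (ℓ : ℝ) ^ (i : ℕ) := by
      intro ℓ; simp only [hval]; push_cast; rfl
    have hlin : ∑ ℓ ∈ Finset.range m, L ℓ * (val ℓ t : ℝ) = φ t := by
      calc ∑ ℓ ∈ Finset.range m, L ℓ * (val ℓ t : ℝ)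
          = ∑ ℓ ∈ Finset.range m, ∑ i, L ℓ * ((t i : ℝ) * (ℓ : ℝ) ^ (i : ℕ)) := by
            refine Finset.sum_congr rfl fun ℓ _ => ?_
            rw [hvalR, Finset.mul_sum]
        _ = ∑ i, ∑ ℓ ∈ Finset.range m, L ℓ * ((t i : ℝ) * (ℓ : ℝ) ^ (i : ℕ)) := Finset.sum_comm
        _ = ∑ i, (t i : ℝ) * x ^ (i : ℕ) := by
            refine Finset.sum_congr rfl fun i _ => ?_
            rw [pow_eq_sum_lagrange m i (by omega) x, Finset.mul_sum]
            exact Finset.sum_congr rfl fun ℓ _ => by ring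
        _ = φ t := rfl
    have hsq : ∑ ℓ ∈ Finset.range m, L ℓ * ((val ℓ t : ℝ) ^ 2) = (φ t) ^ 2 := by
      calc ∑ ℓ ∈ Finset.range m, L ℓ * ((val ℓ t : ℝ) ^ 2)
          = ∑ ℓ ∈ Finset.range m, ∑ i, ∑ j,
              L ℓ * (((t i : ℝ) * (ℓ : ℝ) ^ (i : ℕ)) * ((t j : ℝ) * (ℓ : ℝ) ^ (j : ℕ))) := by
            refine Finset.sum_congr rfl fun ℓ _ => ?_
            rw [hvalR, sq, Finset.sum_mul_sum, Finset.mul_sum]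
            exact Finset.sum_congr rfl fun i _ => by rw [Finset.mul_sum]
        _ = ∑ i, ∑ ℓ ∈ Finset.range m, ∑ j,
              L ℓ * (((t i : ℝ) * (ℓ : ℝ) ^ (i : ℕ)) * ((t j : ℝ) * (ℓ : ℝ) ^ (j : ℕ))) := Finset.sum_comm
        _ = ∑ i, ∑ j, ∑ ℓ ∈ Finset.range m,
              L ℓ * (((t i : ℝ) * (ℓ : ℝ) ^ (i : ℕ)) * ((t j : ℝ) * (ℓ : ℝ) ^ (j : ℕ))) :=
            Finset.sum_congr rfl fun i _ => Finset.sum_comm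
        _ = ∑ i, ∑ j, ((t i : ℝ) * x ^ (i : ℕ)) * ((t j : ℝ) * x ^ (j : ℕ)) := by
            refine Finset.sum_congr rfl fun i _ => Finset.sum_congr rfl fun j _ => ?_
            have hij : (i : ℕ) + (j : ℕ) < m := by omega
            rw [show ((t i : ℝ) * x ^ (i : ℕ)) * ((t j : ℝ) * x ^ (j : ℕ)) =
                (t i : ℝ) * (t j : ℝ) * x ^ ((i : ℕ) + (j : ℕ)) by rw [pow_add]; ring,
              pow_eq_sum_lagrange m _ hij x, Finset.mul_sum]
            exact Finset.sum_congr rfl fun ℓ _ => by rw [pow_add]; ring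
        _ = (φ t) ^ 2 := by rw [hφ, sq, Finset.sum_mul_sum]
    -- assemble
    have h1 : ∑ ℓ : Fin m, L ℓ * (val ℓ t : ℝ) = φ t := by
      rw [Fin.sum_univ_eq_sum_range (fun ℓ => L ℓ * (val ℓ t : ℝ)) m]
      exact hlin
    have h2 : ∑ ℓ : Fin m, L ℓ * ((val ℓ t : ℝ) ^ 2) = (φ t) ^ 2 := by
      rw [Fin.sum_univ_eq_sum_range (fun ℓ => L ℓ * ((val ℓ t : ℝ) ^ 2)) m]
      exact hsq
    have hpt : (![φ t, (φ t) ^ 2] : Fin 2 → ℝ) =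
        ∑ ℓ : Fin m, (![L ℓ * (val ℓ t : ℝ), L ℓ * ((val ℓ t : ℝ) ^ 2)] : Fin 2 → ℝ) := by
      rw [vec2_sum, h1, h2]
    rw [hpt]
    exact hsum_mem
  · -- on the parabola
    refine parabola_convexIndependent _ fun s hs => ?_
    obtain ⟨t, -, rfl⟩ := Finset.mem_image.1 (Finset.mem_coe.1 hs)
    simp
  · -- |S| = n^k
    rw [hS, Finset.card_image_of_injOn, hT, Fintype.card_piFinset]
    · simp
    intro t ht s hs h
    have htn : ∀ i, t i < n := fun i => Finset.mem_range.1 (Fintype.mem_piFinset.1 (Finset.mem_coe.1 ht) i)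
    have hsn : ∀ i, s i < n := fun i => Finset.mem_range.1 (Fintype.mem_piFinset.1 (Finset.mem_coe.1 hs) i)
    have h0 : φ t = φ s := by simpa using congrFun h 0
    have hnat : ∑ i, t i * n ^ (i : ℕ) = ∑ i, s i * n ^ (i : ℕ) := by
      have e : ∀ u : Fin k → ℕ, ((∑ i, u i * n ^ (i : ℕ) : ℕ) : ℝ) = φ u := by
        intro u; simp only [hφ, hx]; push_cast; rfl
      exact_mod_cast (e t).trans (h0.trans (e s).symm)
    exact digits_injective n k t s htn hsn hnat

/-- **`M_{2k-1}(N) ≥ c_k N^k`: the exponent of `M_{2k-1}` is at least `k`.**  For `k ≥ 1` there are no `C`, `e < k`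
with `#S ≤ C (N+2)^e` for all convexly independent subsets `S` of `(2k-1)`-fold Minkowski sums of planar `N`-sets.
(KPTT Prop. 1 gives exponent `≥ (2k-1)/3`.)  For the line: a witness `(r, δ)` of `stub_blockConvexBound` with
`r = 2k-1` has `(2/3-δ)(2k-1) ≥ k`; block convexity certifies no slope below `k/(2k-1) > 1/2`. [this file] -/
theorem blockConvexBound_exponent_lt (k : ℕ) (hk : 1 ≤ k) (C e : ℝ) (he : e < k) :
    ¬ ∀ (N : ℕ) (P : Fin (2 * k - 1) → Finset (Fin 2 → ℝ)) (S : Finset (Fin 2 → ℝ)),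
        (∀ ℓ, (P ℓ).card ≤ N) → S ⊆ ∑ ℓ, P ℓ →
          ConvexIndependent ℝ (Subtype.val : ↥(S : Set (Fin 2 → ℝ)) → (Fin 2 → ℝ)) →
            (S.card : ℝ) ≤ C * ((N : ℝ) + 2) ^ e := by
  intro H
  have hK : (1 : ℝ) ≤ ((k * (2 * k - 1) ^ (k - 1) : ℕ) : ℝ) := by
    have : 1 ≤ k * (2 * k - 1) ^ (k - 1) := Nat.mul_pos (by omega) (Nat.pow_pos (by omega))
    exact_mod_cast this
  refine no_power_bound k hk _ e C hK he fun n => ?_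
  obtain ⟨P, S, hP, hS, hci, hcard⟩ := lagrange_sets_parabola k n hk
  have := H (k * (2 * k - 1) ^ (k - 1) * n) P S hP hS hci
  rw [hcard] at this
  exact_mod_cast this

/-- Odd block counts in the stub's own normal form: if `(2/3 - δ)·(2k-1)` works for `r = 2k-1` then
`(2/3 - δ)(2k-1) ≥ k`, i.e. `δ ≤ 2/3 - k/(2k-1) = (k-2)/(3(2k-1)) < 1/6`. [this file] -/
theorem blockConvexBound_odd_delta_le (k : ℕ) (hk : 1 ≤ k) (δ C : ℝ)
    (H : ∀ (N : ℕ) (P : Fin (2 * k - 1) → Finset (Fin 2 → ℝ)) (S : Finset (Fin 2 → ℝ)),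
        (∀ ℓ, (P ℓ).card ≤ N) → S ⊆ ∑ ℓ, P ℓ →
          ConvexIndependent ℝ (Subtype.val : ↥(S : Set (Fin 2 → ℝ)) → (Fin 2 → ℝ)) →
            (S.card : ℝ) ≤ C * ((N : ℝ) + 2) ^ ((2 / 3 - δ) * (((2 * k - 1 : ℕ) : ℝ)))) :
    (k : ℝ) ≤ (2 / 3 - δ) * (((2 * k - 1 : ℕ) : ℝ)) := by
  by_contra hlt
  push Not at hlt
  exact blockConvexBound_exponent_lt k hk C _ hlt H

end

end Summit.ValiantsHypothesis.ValiantsHypothesis.Theorems.NewtonFramesNewtonTauWeak.BlockConvexLagrange
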